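import Summits.CriticalPhenomena.PercolationContinuityZ3.Theorems.Transplant.SkelNeg1ParamsKit
import Summits.CriticalPhenomena.PercolationContinuityZ3.Theorems.Transplant.PlanarSkeletonNeg1
import HarnessLib

/-!
# N1 params, part 2 (p-level values, skeleton-level): THE CONSTANTS OF THE {±1} NODE'S CHOICE FUNCTION THAT ARE FIXED BEFORE STEP I″ —
# `PlanarSkeletonNeg.Neg.K/Kq/cells/C'/cmax/δkit/δI/η` as functions of the handed constants `κ : SkelConc.Consts` and the skeleton `Φ : PlanarSkeletonNeg G`
# (twin of `PlanarSkeletonSign.Sgn` §1, SkelSign1Params p253201, with `a, A, L, m₀` GONE and `K ≡ 0 mod 40`), and their facts BY NAME for the residues;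
# plus (§0, `Skelφ.NegPrm`) the admissibility of the scale list `SMn` under Step I″'s threshold function `n₁ : ℕ → ℕ`

builds on p205010 (kernel theorem, internal audit signed; external expert review pending) — nothing in this file uses p205010; NOTHING is claimed about
the node `SamePDropOfSkeletonNeg₁` (OPEN).
Status sentence (coordinator 2026-08-20T04:30Z): "θ(p_c) = 0 on ℤ^d, all d ≥ 2 — kernel-verified (Lean 4/Mathlib, standard axioms); internal adversarial
audit SIGNED 2026-08-20 04:29Z; external expert review pending."
Lane `prim-bschramm-*`, seat `prim-bschramm-stmt` (gen 12); helper file (`--supports stmt-CriticalPhenomena-4575 --as helper`); ledger HOME/prim-bschramm-stmt/NEG-PARAMS.md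
v0.5 §0 (n0)–(n1), §5.  ORDER (N.3 for N1, p-level part): handed `κ = (K₀, δ, δ₂, δr)` (the closure hands `δ := δC_N(ε)` with `nmaxN = 2000`, p3's
`SkelNeg1Closure`) → `K := Kcell K₀ = 40·(Kof K₀/40 + 1)` (`κ.K₀ ≤ K`, `40 ∣ K`), one-unit cells `⟨K, 1⟩` → the instance constants `C′ := 8` (D4's depth
fraction, p3 Q7) and `c_max := 3` (cells per run, hp-8 §11 (ii)) → the accuracies `δkit := Prm.δkit G Φ.degree_le κ 0` (budget `nmax 0 = 1000`: below `κ.δ`,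
`κ.δ₂`, every `κ.δr n` and every inner-chain accuracy `δUP n (δ₂²)` for `n ≤ 1000`), `δI := δkit²/16` (Step I″ is asked for `1 − δI`), `η := δkit/2` (excess).
Everything after Step I″ (`M_u, n_s, …, negChoice₀`) waits for (L0-4) `StepI.DataN` and p3's `SkelNeg1Choice` (NEG-PARAMS §3).
[cite: KozmaNitzan2024, §4 Theorem 6 (pp. 25–31): the order of constants] [cite: MartineauTassion2017, §3.2]
-/

noncomputable section

namespace Summit.CriticalPhenomena.PercolationContinuityZ3.Theorems.Transplant

namespace Skelφ.NegPrm

/-! ## §0 Admissibility of the scale list under Step I″'s threshold FUNCTION (ledger V0 = option 1: `n₁ : ℕ → ℕ`) -/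

/-- **The scale list is admissible**: if both boxes are `≥ M₀` and both widths are above the threshold at their box (`n₁ M_s ≤ n_s`, `n₁ M_L ≤ n_L`),
then every listed pair `(M, n) ∈ SMn` has `M₀ ≤ M` and `n₁ M ≤ n` — the `S_adm` clause of the N1 choice structure for the piece-links (the zone list
`Prm.SzOf M_u` is served by `Prm.SzOf_adm`). [folklore] -/
theorem SMn_adm {n₁ : ℕ → ℕ} {M₀ Ms ns ML nL : ℕ} (hMs : M₀ ≤ Ms) (hns : n₁ Ms ≤ ns) (hML : M₀ ≤ ML) (hnL : n₁ ML ≤ nL) :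
    ∀ x ∈ SMn Ms ns ML nL, M₀ ≤ x.1 ∧ n₁ x.1 ≤ x.2 := by
  intro x hx
  rcases mem_SMn_iff.1 hx with rfl | rfl
  · exact ⟨hMs, hns⟩
  · exact ⟨hML, hnL⟩

/-- **Admissibility at the ledger's values** (any `R′`-slot, any clearance slot `f`): with `n_s := nS (n₁ M_u) M_u R′ ρz`, `M_L := ML M_u …` and
`n_L := nL (max (n₁ M_L) f) M_L K R″`, every listed pair is admissible as soon as `M₀ ≤ M_u`. [folklore] -/
theorem SMn_adm_ledger (n₁ : ℕ → ℕ) {M₀ Mu : ℕ} (hMu : M₀ ≤ Mu) (R' ρz C' cmax K R'' hs ls f : ℕ) :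
    ∀ x ∈ SMn Mu (nS (n₁ Mu) Mu R' ρz) (ML Mu C' cmax K R'' hs ls (nS (n₁ Mu) Mu R' ρz))
        (nL (max (n₁ (ML Mu C' cmax K R'' hs ls (nS (n₁ Mu) Mu R' ρz))) f) (ML Mu C' cmax K R'' hs ls (nS (n₁ Mu) Mu R' ρz)) K R''),
      M₀ ≤ x.1 ∧ n₁ x.1 ≤ x.2 :=
  SMn_adm hMu (n₁_le_nS _ _ _ _) (hMu.trans (Mu_le_ML _ _ _ _ _ _ _ _)) (rootClear_le_nL _ f _ K R'').1

end Skelφ.NegPrm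

namespace PlanarSkeletonNeg

namespace Neg

open Literature.Probability.Percolation Literature.Probability.LatticeModels SimpleGraph
open SkelConc (Consts)
open BoxProdZ2 (Kof)

section Handed

variable (κ : Consts)

/-! ## §1 From the handed constants: the cell constant and the cells -/

/-- **The cell constant of N1** `K := Kcell K₀ = 40·(Kof K₀/40 + 1)`. [this work] -/
def K : ℕ := Skelφ.NegPrm.Kcell κ.K₀

/-- **One stride in ρ-units** `Kq := Kof K₀/40 + 1` (`K = 40·Kq`). [this work] -/
def Kq : ℕ := Skelφ.NegPrm.Kq κ.K₀

/-- **The one-unit planar cells of N1** `⟨K, 1⟩` (density-free AND Step-I″-free). [this work] -/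
def cells : PCells2 := Skelφ.NegPrm.cells κ.K₀

/-- `K = 40·Kq`. [folklore] -/
theorem K_eq : Neg.K κ = 40 * Neg.Kq κ := rfl

/-- `κ.K₀ ≤ K` (the `WFHolds` clause `κ.K₀ ≤ (P O).K`). [folklore] -/
theorem K₀_le_K : κ.K₀ ≤ Neg.K κ := Skelφ.NegPrm.K₀_le_Kcell κ.K₀

/-- `Kof κ.K₀ ≤ K ≤ Kof κ.K₀ + 40`. [folklore] -/
theorem Kof_le_K : Kof κ.K₀ ≤ Neg.K κ ∧ Neg.K κ ≤ Kof κ.K₀ + 40 := ⟨Skelφ.NegPrm.Kof_le_Kcell κ.K₀, Skelφ.NegPrm.Kcell_le κ.K₀⟩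

/-- `40 ≤ K`, `20 ≤ K`, `1 ≤ K`. [folklore] -/
theorem forty_le_K : 40 ≤ Neg.K κ ∧ 20 ≤ Neg.K κ ∧ 1 ≤ Neg.K κ := Skelφ.NegPrm.forty_le_Kcell κ.K₀

/-- `1 ≤ Kq`. [folklore] -/
theorem one_le_Kq : 1 ≤ Neg.Kq κ := Skelφ.NegPrm.one_le_Kq κ.K₀

/-- `40 ∣ K` and `K / 40 = Kq`. [folklore] -/
theorem forty_dvd_K : 40 ∣ Neg.K κ ∧ Neg.K κ / 40 = Neg.Kq κ := ⟨(Skelφ.NegPrm.forty_dvd_Kcell κ.K₀).1, (Skelφ.NegPrm.forty_dvd_Kcell κ.K₀).2.1⟩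

/-- The cells' `K` is `Neg.K κ`. [folklore] -/
theorem cells_K : (Neg.cells κ).K = Neg.K κ := rfl

/-- The cells' stub increments are `1`. [folklore] -/
theorem cells_s (i : Fin 2) : (Neg.cells κ).s i = 1 := rfl

/-- The cells' units are `r_i = K` on both axes. [folklore] -/
theorem cells_r (i : Fin 2) : (Neg.cells κ).r i = Neg.K κ := Skelφ.NegPrm.cells_r κ.K₀ i

/-- `rmax = K`. [folklore] -/
theorem cells_rmax : (Neg.cells κ).rmax = Neg.K κ := Skelφ.NegPrm.cells_rmax κ.K₀

/-- `κ.K₀ ≤ (cells κ).K`. [folklore] -/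
theorem K₀_le_cells_K : κ.K₀ ≤ (Neg.cells κ).K := Skelφ.NegPrm.K₀_le_cells_K κ.K₀

/-! ## §2 The instance constants `C′` and `c_max` -/

/-- **D4's depth fraction** `C′ := 8` (a `P_s` kit route's displacement read in the long frame is `≤ ℓ_L/C′`; p3-g8 Q7, NEG-PARAMS §9). [this work] -/
def C' : ℕ := 8

/-- **Cells per run** `c_max := 3` (hp-8 §11 (ii): the y′-layer slack floor `320·c_max ≤ M_L + 1`). [this work] -/
def cmax : ℕ := 3

/-- `C′ = 8`, `1 ≤ C′`, `2·C′ = 16`. [folklore] -/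
theorem C'_eq : Neg.C' = 8 ∧ 1 ≤ Neg.C' ∧ 2 * Neg.C' = 16 := ⟨rfl, by decide, rfl⟩

/-- `c_max = 3` and `320·c_max = 960`. [folklore] -/
theorem cmax_eq : Neg.cmax = 3 ∧ 320 * Neg.cmax = 960 := ⟨rfl, rfl⟩

end Handed

section Acc

variable (κ : Consts) {V : Type} [DecidableEq V] [Countable V] {G : SimpleGraph V} [G.LocallyFinite] (Φ : PlanarSkeletonNeg G)

/-! ## §3 The accuracies -/

/-- **The kit accuracy of N1** `δkit := Prm.δkit G Φ.degree_le κ 0` (budget `nmax 0 = 1000`). [this work] -/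
def δkit : ℝ := Skelφ.Prm.δkit G Φ.degree_le κ 0

/-- **The Step-I″ accuracy of N1** `δI := Prm.δI G Φ.degree_le κ 0 = δkit²/16`. [this work] -/
def δI : ℝ := Skelφ.Prm.δI G Φ.degree_le κ 0

/-- **The excess accuracy** `η := δkit/2`. [this work] -/
def η : ℝ := Neg.δkit κ Φ / 2

/-- `0 < δkit`. [folklore] -/
theorem δkit_pos : 0 < Neg.δkit κ Φ := Skelφ.Prm.δkit_pos G Φ.degree_le κ 0

/-- `δkit ≤ 1`. [folklore] -/
theorem δkit_le_one : Neg.δkit κ Φ ≤ 1 := Skelφ.Prm.δkit_le_one G Φ.degree_le κ 0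

/-- `δkit ≤ κ.δ` (the corridor kits). [folklore] -/
theorem δkit_le_δ : Neg.δkit κ Φ ≤ κ.δ := Skelφ.Prm.δkit_le_δ G Φ.degree_le κ 0

/-- `δkit ≤ κ.δ₂` (the face kits). [folklore] -/
theorem δkit_le_δ₂ : Neg.δkit κ Φ ≤ κ.δ₂ := Skelφ.Prm.δkit_le_δ₂ G Φ.degree_le κ 0

/-- `δkit ≤ κ.δr n` for every root-run length `n ≤ 1000` (`N_R + 1 ≤ 481`). [folklore] -/
theorem δkit_le_δr {n : ℕ} (hn : n ≤ 1000) : Neg.δkit κ Φ ≤ κ.δr n := Skelφ.NegPrm.δkit₀_le_δr G Φ.degree_le κ hn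

/-- `δkit ≤ δUP n (δ₂²)` for every inner-chain length `n ≤ 1000` (`n_F = 880`). [folklore] -/
theorem δkit_le_δUP {n : ℕ} (hn : n ≤ 1000) : Neg.δkit κ Φ ≤ Skelφ.δUP G Φ.degree_le n (κ.δ₂ ^ 2) :=
  Skelφ.NegPrm.δkit₀_le_δUP G Φ.degree_le κ hn

/-- `0 < δI`. [folklore] -/
theorem δI_pos : 0 < Neg.δI κ Φ := Skelφ.Prm.δI_pos G Φ.degree_le κ 0

/-- `δI ≤ 1`. [folklore] -/
theorem δI_le_one : Neg.δI κ Φ ≤ 1 := Skelφ.Prm.δI_le_one G Φ.degree_le κ 0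

/-- `δI = (δkit/4)²` and `δI ≤ δkit²`. [folklore] -/
theorem δI_eq : Neg.δI κ Φ = (Neg.δkit κ Φ / 4) ^ 2 ∧ Neg.δI κ Φ ≤ Neg.δkit κ Φ ^ 2 :=
  ⟨Skelφ.Prm.δI_eq G Φ.degree_le κ 0, Skelφ.Prm.δI_le_sq G Φ.degree_le κ 0⟩

/-- `δI ≤ a²` whenever `δkit ≤ a` (the consumers' `1 − a²` thresholds from the Step-I″ inputs `> 1 − δI`). [folklore] -/
theorem δI_le_sq_of_le {a : ℝ} (ha : Neg.δkit κ Φ ≤ a) : Neg.δI κ Φ ≤ a ^ 2 := Skelφ.Prm.δI_le_sq_of_le G Φ.degree_le κ 0 ha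

/-- `0 < η`, `η ≤ δkit/2`, `2η = δkit`. [folklore] -/
theorem η_pos : 0 < Neg.η κ Φ ∧ Neg.η κ Φ ≤ Neg.δkit κ Φ / 2 ∧ 2 * Neg.η κ Φ = Neg.δkit κ Φ := by
  refine ⟨?_, le_rfl, ?_⟩
  · unfold η; exact half_pos (Neg.δkit_pos κ Φ)
  · unfold η; ring

/-- **Monotonicity of the Step-I″ inputs in the threshold**: an input `> 1 − δI` is `> 1 − b` for every `b ≥ δI`. [folklore] -/
theorem inputs_mono {b P : ℝ} (hb : Neg.δI κ Φ ≤ b) (h : 1 - Neg.δI κ Φ < P) : 1 - b < P := by linarith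

end Acc

end Neg

end PlanarSkeletonNeg

end Summit.CriticalPhenomena.PercolationContinuityZ3.Theorems.Transplant

end
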